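import Summits.Ventures.PercRepro2.CaseOneStarCertT1
import Summits.Ventures.PercRepro2.CaseOneGadgetUWA1OBlockIT0
import Summits.Ventures.PercRepro2.CaseOneGadgetUWA1OBlockIT1
import Summits.Ventures.PercRepro2.CaseOneGadgetUWA1OBlockIT2
import Summits.Ventures.PercRepro2.CaseOneGadgetUWA1OBlockIT3
import Summits.Ventures.PercRepro2.CaseOneGadgetUWA1OBlockIT4
import Summits.Ventures.PercRepro2.CaseOneGadgetUWA1OBlockIT5
import Summits.Ventures.PercRepro2.CaseOneGadgetUWA1OBlockIT6
import Summits.Ventures.PercRepro2.CaseOneGadgetUWA1OBlockIT7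
import Summits.Ventures.PercRepro2.CaseOneGadgetUWA1OBlockIT8
import Summits.Ventures.PercRepro2.CaseOneGadgetUWA1OBlockIT9
import Summits.Ventures.PercRepro2.CaseOneGadgetUWA1OBlockIT10
import Summits.Ventures.PercRepro2.CaseOneGadgetUWA1OBlockIT11
import Summits.Ventures.PercRepro2.CaseOneGadgetUWA1OBlockIT12R
import Summits.Ventures.PercRepro2.CaseOneGadgetUWA1OBlockIT13

/-!
# The gadget `u ~ {w, a₁, o}`, `w ~ {u, a₂, b}` (uwa1o): the cell certificates of `iTAO5` (part 20a)
(blind cell PercRepro2, p1 g34; the fourth gadget anchor of the six-form calculus — all six forms of the uwa1o gadget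
as plain SFacts-cone certificate chains, generated by mining/p1/g34/uwa1o/genu.py = p1 g33's gent_uwa1.py / g25's
geno.py re-targeted; P1-G33 §6–§6″, P1-G34)

Each `eBAOIT ijk kl` is a nonnegative combination of `(pairwise atom) × (cell)` and cubic cell monomials — or, for the degree-4 ones, `M × eBAOIT ijk kl` (`M = Σ cᵢ` the total cell mass) is a nonnegative combination of `(atom) × (cell) × (cell)` and quartic cell monomials, then `SFacts.nonneg_of_sum_mul` (`CaseOneStarCertT1`) — exact LP certificates (kit j317114, every certificate re-verified exactly; data/p1/g33/gcerts_uwa1o.json, form `i-T`), here as exact `linear_combination`s over `SFacts` (the rational coefficients cleared by their common denominator). -/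

namespace Summit.Ventures.PercRepro2

namespace CaseOne

section CertAOIT20a
variable {R : Type*} [Field R] [LinearOrder R] [IsStrictOrderedRing R]

set_option maxHeartbeats 0 in
/-- `eBAOIT32221R ≥ 0`: the combination is identically zero (`ring`). -/
lemma eBAOIT32221R_nonneg (m : SCells R) (_hf : SFacts m) : 0 ≤ eBAOIT32221R m := by
  have h : eBAOIT32221R m = 0 := by
    unfold eBAOIT32221R cBAOIT00221 cBAOIT01121 cBAOIT01221 cBAOIT02121 cBAOIT02221 cBAOIT10121 cBAOIT10221 cBAOIT11021 cBAOIT11121 cBAOIT11221 cBAOIT12021 cBAOIT12121 cBAOIT12221 cBAOIT20021 cBAOIT20121 cBAOIT20221 cBAOIT21021 cBAOIT21121 cBAOIT21221 cBAOIT22021 cBAOIT22121 cBAOIT22221 cBAOIT30121 cBAOIT30221 cBAOIT31021 cBAOIT31121 cBAOIT31221 cBAOIT32021 cBAOIT32121 cBAOIT32221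
    ring
  linarith [h]

set_option maxHeartbeats 0 in
/-- `eBAOIT32222R ≥ 0`: the combination is identically zero (`ring`). -/
lemma eBAOIT32222R_nonneg (m : SCells R) (_hf : SFacts m) : 0 ≤ eBAOIT32222R m := by
  have h : eBAOIT32222R m = 0 := by
    unfold eBAOIT32222R cBAOIT00222 cBAOIT01122 cBAOIT01222 cBAOIT02122 cBAOIT02222 cBAOIT10122 cBAOIT10222 cBAOIT11022 cBAOIT11122 cBAOIT11222 cBAOIT12022 cBAOIT12122 cBAOIT12222 cBAOIT20022 cBAOIT20122 cBAOIT20222 cBAOIT21022 cBAOIT21122 cBAOIT21222 cBAOIT22022 cBAOIT22122 cBAOIT22222 cBAOIT30122 cBAOIT30222 cBAOIT31022 cBAOIT31122 cBAOIT31222 cBAOIT32022 cBAOIT32122 cBAOIT32222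
    ring
  linarith [h]

end CertAOIT20a

end CaseOne

end Summit.Ventures.PercRepro2
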